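import Literature.Computability.AlgebraicComplexity.OrbitClosureDimension
import Literature.Computability.AlgebraicComplexity.OrbitClosureProofs

/-!
# A form with a smaller annihilator is not a degeneration

For non-zero forms `P, Q ∈ S^n W^*` (`W = ℂ^σ`): if the annihilator `𝔤𝔩(W)_P` (`glAnn P`, the Lie
algebra of the stabiliser) has smaller dimension than `𝔤𝔩(W)_Q`, then `P ∉ Δ(Q) = \overline{GL(W)·Q}`
(`not_mem_orbitClosure_of_finrank_glAnn_lt`).  Indeed `P ∈ Δ(Q)` gives `Δ(P) ⊆ Δ(Q)`
(`orbitClosure_subset_of_mem_holds`), hence `dim Δ(P) ≤ dim Δ(Q)`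
(`affineDimension_orbitClosure_le_of_subset`, from the tree's strictness theorem
`affineDimension_orbitClosure_add_one_le_of_ssubset`), while `dim Δ(R) = N² − dim 𝔤𝔩(W)_R`
(`affineDimension_orbitClosure_eq_card_sq_sub_finrank_glAnn`, LMR 2013 §3.5 / Landsberg 2017 §8.5.1).
This is the standard orbit-dimension obstruction to degeneration ("a point of the boundary of an
orbit has a stabiliser of larger dimension"); used in `Summits/…/Theorems/SchenstedIndexBorderPcPerThree*`
for `per_3 ∉ Δ(tr X³)` (border power-trace complexity of `per_3` is at least `4`).

HONEST FRAMING: bookkeeping over the tree's orbit-closure dimension theory; nothing here bears on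
`VP ≠ VNP`.
-/

noncomputable section

namespace Literature.Computability.AlgebraicComplexity

open Module

variable {σ : Type*} [Fintype σ] [DecidableEq σ]

/-- **Monotonicity of the orbit-closure dimension**: for non-zero forms `P, Q` of degree `n`,
`Δ(P) ⊆ Δ(Q) ⇒ dim Δ(P) ≤ dim Δ(Q)` (equality of closures gives equality; a proper inclusion drops
the dimension by the tree's `affineDimension_orbitClosure_add_one_le_of_ssubset`).
[cite: Hartshorne1977, I Prop. 1.10 and Ex. 1.10 (d) (p. 8)] -/
theorem affineDimension_orbitClosure_le_of_subset {P Q : MvPolynomial σ ℂ} {n : ℕ}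
    (hP : P.IsHomogeneous n) (hQ : Q.IsHomogeneous n) (hP0 : P ≠ 0) (hQ0 : Q ≠ 0)
    (hsub : orbitClosure P ⊆ orbitClosure Q) :
    affineDimension (formCoeff n '' orbitClosure P) ≤
      affineDimension (formCoeff n '' orbitClosure Q) := by
  by_cases hrev : orbitClosure Q ⊆ orbitClosure P
  · rw [Set.Subset.antisymm hsub hrev]
  · exact (Nat.le_succ _).trans
      (affineDimension_orbitClosure_add_one_le_of_ssubset hP hQ hP0 hQ0 hsub hrev)

/-- **Annihilators only grow under degeneration**: for non-zero forms `P, Q` of degree `n` with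
`P ∈ Δ(Q)`, `dim 𝔤𝔩(W)_Q ≤ dim 𝔤𝔩(W)_P` (`dim Δ(P) = N² − dim 𝔤𝔩(W)_P ≤ N² − dim 𝔤𝔩(W)_Q = dim Δ(Q)`).
[cite: LandsbergManivelRessayre2013, §3.5 (p. 481); Landsberg2017, §8.5.1] -/
theorem finrank_glAnn_le_of_mem_orbitClosure {P Q : MvPolynomial σ ℂ} {n : ℕ}
    (hP : P.IsHomogeneous n) (hQ : Q.IsHomogeneous n) (hP0 : P ≠ 0) (hQ0 : Q ≠ 0)
    (hmem : P ∈ orbitClosure Q) :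
    finrank ℂ (glAnn Q) ≤ finrank ℂ (glAnn P) := by
  have hsub : orbitClosure P ⊆ orbitClosure Q := orbitClosure_subset_of_mem_holds hmem
  have hdim := affineDimension_orbitClosure_le_of_subset hP hQ hP0 hQ0 hsub
  rw [affineDimension_orbitClosure_eq_card_sq_sub_finrank_glAnn hP,
    affineDimension_orbitClosure_eq_card_sq_sub_finrank_glAnn hQ] at hdim
  have h1 := finrank_glTangent_add_finrank_glAnn P
  have h2 := finrank_glTangent_add_finrank_glAnn Q
  omega

/-- **A form with a smaller annihilator is not a degeneration**: for non-zero forms `P, Q` of degree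
`n`, `dim 𝔤𝔩(W)_P < dim 𝔤𝔩(W)_Q ⇒ P ∉ Δ(Q)` (the orbit of `P` has dimension `N² − dim 𝔤𝔩(W)_P`,
larger than `dim Δ(Q) = N² − dim 𝔤𝔩(W)_Q`). [cite: LandsbergManivelRessayre2013, §3.5 (p. 481); Landsberg2017, §8.5.1] -/
theorem not_mem_orbitClosure_of_finrank_glAnn_lt {P Q : MvPolynomial σ ℂ} {n : ℕ}
    (hP : P.IsHomogeneous n) (hQ : Q.IsHomogeneous n) (hP0 : P ≠ 0) (hQ0 : Q ≠ 0)
    (h : finrank ℂ (glAnn P) < finrank ℂ (glAnn Q)) : P ∉ orbitClosure Q := fun hmem =>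
  absurd (finrank_glAnn_le_of_mem_orbitClosure hP hQ hP0 hQ0 hmem) (not_le.2 h)

end Literature.Computability.AlgebraicComplexity

end
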